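import Summits.QuantumFields.YangMills.Theorems.BalabanLadderNTWeakPackageNestedCumulant
import Summits.QuantumFields.YangMills.Theorems.BalabanLadderNTBoundaryLawClusteringAllCubes
import HarnessLib

/-!
# Crux `NT` (stmt-QuantumFields-19353), stub `stub_cfpw : CFPW`: the signed third-cumulant clause (T) on SPARSE radii

Helper file (`--supports stmt-QuantumFields-19353`) of the fleet lead prover of crux `NT` (unit `ym-spine-19353-p1`,
g3); the three-point twin of `…NTWeakPackageCover` (the floor clause (F) on a covering set of radii) — an unconditional
reduction on the ENGINE side of the registered stub `stub_cfpw : CFPW` (skeleton v3 «weak-package», 374f16092bb0c203).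

The weak third-cumulant clause (T) of `CFPW` (text: `Theorems/BalabanLadderNTWeakPackage.lean`; antitone single-collar
form: `WeakPackage.fc3Weak_of_antitoneCollar`) asks for the SIGNED conditional third-cumulant floor
`c₃ Γ₃(n a) ≤ σ n¹² · kerK3_{Q,η}(x, y, z)` at the reference triangle `y − x ≈ n v`, `z − x ≈ n w` on EVERY x-centred femto
cube `Q = [x−R, x+R]⁴` holding the triangle at depth `≥ K₃ · n`.  A multiscale engine proves such statements on its own
cube sizes; `fc3Weak_of_cover` shows that suffices, given the boundary law `FBL G r a`:

* the floor on the x-centred cube of a covering radius `R₀ ∈ S` (`R₀ ≤ R`, `R+1 ≤ θ(R₀+1)`) transfers to radius `R` by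
  the law of total cumulance through the nested sub-cube (`kerK3_lower_of_nested`): the error is
  `6 h₀ cc + 8 h₀³` with `h₀ = C₁/((1+κ) n)⁴` (boundary law for the three `R₀`-kernel means) and
  `cc = C₂/(δ₀ n)⁸` (the SIGN-FREE conditional clustering of the three pairs inside the `R₀`-cube, which follows from
  `FBL` alone: `BoundaryLaw.fc2IU_of_fbl`, collar `κ₂`, threshold `n₀`; `δ₀ = δ ∧ (‖v−w‖ − 2δ)` bounds the pairwise
  separations below by `δ₀ n`);
* the enlarged collar `K₃'(s) = θ (K₃(s) + κ(s) + (2κ₂+1)Λ + 1)`, `Λ = (‖v‖ ∨ ‖w‖) + δ`,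
  `κ(s) = (max 0 (24 C₁C₂/(δ₀⁸ c₃ Γ₃(s∧ℓ₃))))^{1/4} + (max 0 (32 C₁³/(c₃ Γ₃(s∧ℓ₃))))^{1/12}` makes each error term a
  quarter of the signal; `s κ(s) → 0` BY the growth clause `Γ₃(s)/s⁴ → ∞` (this is what that clause is for), and `κ`
  is antitone when `Γ₃` is positive and monotone on `(0, ℓ₃]` (as the engine's one-loop `Γ₃ ≍ g⁶`-type shape is).

Result: (T) on ALL radii in the antitone single-collar form with constant `c₃/2`.  The registered `∀ s₀` form and the
geometric-sequence corollary are in the sibling `…NTWeakPackageCoverThreePointSeq`.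
-/

set_option autoImplicit false

noncomputable section

open MeasureTheory Filter Topology
open Literature.MathematicalPhysics.QuantumFieldTheory Literature.MathematicalPhysics.QuantumLattice
open Literature.Probability.LatticeModels
open Summit.QuantumFields.YangMills.Cruxes.OSLegsFromFemtoAndGap.DlrCollarTransfer
open Summit.QuantumFields.YangMills.Cruxes.OSLegsFromFemtoAndGap.DlrCollarTransfer.StubLower
  (exists_abs_dens_le le_depth_cube)
open Summit.QuantumFields.YangMills.Cruxes.NT.BoundaryLaw (fc2IU_of_fbl)

namespace Summit.QuantumFields.YangMills.Cruxes.NT.WeakPackage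

section Lattice

variable (G : Type) [Group G] [TopologicalSpace G] [IsTopologicalGroup G] [CompactSpace G]
  [MeasurableSpace G] [BorelSpace G] (r : LatticeRep G) (a : ℝ → ℝ)

set_option maxHeartbeats 400000 in
/-- **The weak third-cumulant clause (T) from the signed floor on a covering set of radii, given `FBL`.**  Let
`0 < a`, `FBL G r a`, and `S ⊆ ℕ` cover every radius `R ≥ D` up to the factor `θ ≥ 1`.  Suppose the signed conditional
third-cumulant floor holds on the x-centred femto cubes of radii `R₀ ∈ S` — antitone collar `K₃ ≥ 1` with
`s K₃(s) → 0`, shape `Γ₃` positive and monotone on `(0, ℓ₃]` with `Γ₃(s)/s⁴ → ∞`, reference triangle `(v, w, δ)`, sign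
`σ`, single depth condition `K₃(n a) n ≤ depth` at `x, y, z`.  Then the clause holds on ALL x-centred femto cubes, in
the antitone single-collar form of `fc3Weak_of_antitoneCollar`, with constant `c₃/2`. [folklore] -/
theorem fc3Weak_of_cover (ha : ∀ β, 0 < a β) (hFBL : FBL G r a) (S : Set ℕ) (θ : ℝ) (hθ : 1 ≤ θ) (D : ℕ)
    (hcover : ∀ R : ℕ, D ≤ R → ∃ R₀ ∈ S, R₀ ≤ R ∧ (R : ℝ) + 1 ≤ θ * ((R₀ : ℝ) + 1))
    (h : ∃ (v w : EuclideanSpace ℝ (Fin 4)) (σ δ : ℝ) (Γ₃ : ℝ → ℝ) (β₃ ℓ₃ c₃ : ℝ) (K₃ : ℝ → ℝ) (n₃ : ℕ),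
      (σ = 1 ∨ σ = -1) ∧ 0 < δ ∧ 2 * δ < ‖v‖ ∧ 2 * δ < ‖w‖ ∧ 2 * δ < ‖v - w‖ ∧ 0 < ℓ₃ ∧ 0 < c₃ ∧
      (∀ s, 1 ≤ K₃ s) ∧ AntitoneOn K₃ (Set.Ioi 0) ∧
      Tendsto (fun s : ℝ => s * K₃ s) (nhdsWithin 0 (Set.Ioi 0)) (nhds 0) ∧
      Tendsto (fun s : ℝ => Γ₃ s / s ^ 4) (nhdsWithin 0 (Set.Ioi 0)) atTop ∧
      (∀ s : ℝ, 0 < s → s ≤ ℓ₃ → 0 < Γ₃ s) ∧ MonotoneOn Γ₃ (Set.Ioc 0 ℓ₃) ∧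
      ∀ β : ℝ, β₃ ≤ β → ∀ (x : Fin 4 → ℤ) (R₀ : ℕ), R₀ ∈ S → ((2 * R₀ + 1 : ℕ) : ℝ) * a β ≤ ℓ₃ →
        ∀ (η : LGConfig 4 G) (n : ℕ) (y z : Fin 4 → ℤ), 0 < (n : ℝ) * a β →
          n₃ ≤ n → ‖siteToE (y - x) - (n : ℝ) • v‖ ≤ δ * n → ‖siteToE (z - x) - (n : ℝ) • w‖ ≤ δ * n →
            K₃ ((n : ℝ) * a β) * n ≤ depth (fun j => x j - R₀) (2 * R₀ + 1) x →
            K₃ ((n : ℝ) * a β) * n ≤ depth (fun j => x j - R₀) (2 * R₀ + 1) y →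
            K₃ ((n : ℝ) * a β) * n ≤ depth (fun j => x j - R₀) (2 * R₀ + 1) z →
              c₃ * Γ₃ ((n : ℝ) * a β) ≤
                σ * (n : ℝ) ^ 12 * kerK3 G r β (fun j => x j - R₀) (2 * R₀ + 1) η x y z) :
    ∃ (v w : EuclideanSpace ℝ (Fin 4)) (σ δ : ℝ) (Γ₃ : ℝ → ℝ) (β₃ ℓ₃ c₃ : ℝ) (K₃ : ℝ → ℝ) (n₃ : ℕ),
      (σ = 1 ∨ σ = -1) ∧ 0 < δ ∧ 2 * δ < ‖v‖ ∧ 2 * δ < ‖w‖ ∧ 2 * δ < ‖v - w‖ ∧ 0 < ℓ₃ ∧ 0 < c₃ ∧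
      (∀ s, 1 ≤ K₃ s) ∧ AntitoneOn K₃ (Set.Ioi 0) ∧
      Tendsto (fun s : ℝ => s * K₃ s) (nhdsWithin 0 (Set.Ioi 0)) (nhds 0) ∧
      Tendsto (fun s : ℝ => Γ₃ s / s ^ 4) (nhdsWithin 0 (Set.Ioi 0)) atTop ∧
      ∀ β : ℝ, β₃ ≤ β → ∀ (x : Fin 4 → ℤ) (R : ℕ), ((2 * R + 1 : ℕ) : ℝ) * a β ≤ ℓ₃ →
        ∀ (η : LGConfig 4 G) (n : ℕ) (y z : Fin 4 → ℤ), 0 < (n : ℝ) * a β →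
          n₃ ≤ n → ‖siteToE (y - x) - (n : ℝ) • v‖ ≤ δ * n → ‖siteToE (z - x) - (n : ℝ) • w‖ ≤ δ * n →
            K₃ ((n : ℝ) * a β) * n ≤ depth (fun j => x j - R) (2 * R + 1) x →
            K₃ ((n : ℝ) * a β) * n ≤ depth (fun j => x j - R) (2 * R + 1) y →
            K₃ ((n : ℝ) * a β) * n ≤ depth (fun j => x j - R) (2 * R + 1) z →
              c₃ * Γ₃ ((n : ℝ) * a β) ≤
                σ * (n : ℝ) ^ 12 * kerK3 G r β (fun j => x j - R) (2 * R + 1) η x y z := by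
  haveI := r.secondCountableTopology
  obtain ⟨v, w, σ, δ, Γ₃, β₃, ℓ₃, c₃, K₃, n₃, hσ, hδ, hv, hw, hvw, hℓ₃, hc₃, hK1, hKanti, hKlim, hΓlim, hΓpos, hΓmono,
    H⟩ := h
  obtain ⟨βU, ℓU, C₂, κ₂, n₀, hℓU, hn₀, HU⟩ := fc2IU_of_fbl G r a hFBL
  obtain ⟨C₁, β₁, ℓ₁, p, hℓ₁, hC₁, HB⟩ := hFBL
  obtain ⟨M, -, hM⟩ := exists_abs_dens_le G r
  have hθ0 : 0 < θ := lt_of_lt_of_le one_pos hθ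
  -- geometry constants of the reference triangle
  set Λ : ℝ := max ‖v‖ ‖w‖ + δ with hΛdef
  have hΛv : ‖v‖ + δ ≤ Λ := by rw [hΛdef]; linarith only [le_max_left ‖v‖ ‖w‖]
  have hΛw : ‖w‖ + δ ≤ Λ := by rw [hΛdef]; linarith only [le_max_right ‖v‖ ‖w‖]
  have hΛ0 : 0 < Λ := by linarith only [hΛv, hδ, norm_nonneg v]
  set δ₀ : ℝ := min δ (‖v - w‖ - 2 * δ) with hδ₀def
  have hδ₀0 : 0 < δ₀ := lt_min hδ (by linarith only [hvw])
  have hδ₀v : δ₀ ≤ ‖v‖ - δ := (min_le_left _ _).trans (by linarith only [hv])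
  have hδ₀w : δ₀ ≤ ‖w‖ - δ := (min_le_left _ _).trans (by linarith only [hw])
  have hδ₀vw : δ₀ ≤ ‖w - v‖ - 2 * δ := by rw [norm_sub_rev]; exact min_le_right _ _
  -- absorption constants and the enlarged collar
  set C₂' : ℝ := max C₂ 0 with hC₂'def
  have hC₂'0 : 0 ≤ C₂' := le_max_right _ _
  set B₁ : ℝ := 24 * C₁ * C₂' / δ₀ ^ 8 with hB₁def
  set B₂ : ℝ := 32 * C₁ ^ 3 with hB₂def
  have hB₁0 : 0 ≤ B₁ := by rw [hB₁def]; positivity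
  have hB₂0 : 0 ≤ B₂ := by rw [hB₂def]; positivity
  have hA₁0 : 0 ≤ B₁ / c₃ := div_nonneg hB₁0 hc₃.le
  have hA₂0 : 0 ≤ B₂ / c₃ := div_nonneg hB₂0 hc₃.le
  let κa : ℝ → ℝ := fun s => (max 0 (B₁ / c₃ / Γ₃ (min s ℓ₃))) ^ ((4 : ℕ) : ℝ)⁻¹
  let κb : ℝ → ℝ := fun s => (max 0 (B₂ / c₃ / Γ₃ (min s ℓ₃))) ^ ((12 : ℕ) : ℝ)⁻¹
  have hκa0 : ∀ s, 0 ≤ κa s := fun s => Real.rpow_nonneg (le_max_left _ _) _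
  have hκb0 : ∀ s, 0 ≤ κb s := fun s => Real.rpow_nonneg (le_max_left _ _) _
  set T₀ : ℝ := (2 * (κ₂ : ℝ) + 1) * Λ + 1 with hT₀def
  have hκ₂0 : (0 : ℝ) ≤ κ₂ := Nat.cast_nonneg κ₂
  have hκ₂Λ : 0 ≤ 2 * (κ₂ : ℝ) * Λ := by positivity
  have hT₀1 : 1 ≤ T₀ := by
    have : 0 ≤ (2 * (κ₂ : ℝ) + 1) * Λ := by positivity
    rw [hT₀def]; linarith only [this]
  let K' : ℝ → ℝ := fun s => θ * (K₃ s + κa s + κb s + T₀)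
  have hK'ge : ∀ s, K₃ s + κa s + κb s + T₀ ≤ K' s := fun s => by
    show K₃ s + κa s + κb s + T₀ ≤ θ * (K₃ s + κa s + κb s + T₀)
    have h0 : 0 ≤ K₃ s + κa s + κb s + T₀ := by linarith only [hK1 s, hκa0 s, hκb0 s, hT₀1]
    exact le_mul_of_one_le_left h0 hθ
  have hK'one : ∀ s, 1 ≤ K' s := fun s => by
    have h2 : (1 : ℝ) ≤ K₃ s + κa s + κb s + T₀ := by linarith only [hK1 s, hκa0 s, hκb0 s, hT₀1]
    exact h2.trans (hK'ge s)
  refine ⟨v, w, σ, δ, Γ₃, max (max β₁ βU) β₃, min (min ℓ₁ ℓU) ℓ₃, c₃ / 2, K',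
    max n₃ (max (D + 2) ⌈(n₀ : ℝ) / δ₀⌉₊), hσ, hδ, hv, hw, hvw, lt_min (lt_min hℓ₁ hℓU) hℓ₃, by positivity,
    hK'one, ?_, ?_, hΓlim, ?_⟩
  · -- antitone
    have ha' : AntitoneOn κa (Set.Ioi 0) := antitoneOn_collar_rpow (by positivity) hA₁0 hℓ₃ hΓpos hΓmono
    have hb' : AntitoneOn κb (Set.Ioi 0) := antitoneOn_collar_rpow (by positivity) hA₂0 hℓ₃ hΓpos hΓmono
    intro s hs t ht hst
    have h1 := hKanti hs ht hst
    have h2 := ha' hs ht hst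
    have h3 := hb' hs ht hst
    show θ * (K₃ t + κa t + κb t + T₀) ≤ θ * (K₃ s + κa s + κb s + T₀)
    exact mul_le_mul_of_nonneg_left (by linarith only [h1, h2, h3]) hθ0.le
  · -- `s K'(s) → 0`
    have hκalim : Tendsto (fun s : ℝ => s * κa s) (nhdsWithin 0 (Set.Ioi 0)) (nhds 0) :=
      tendsto_mul_collar_rpow (by norm_num) hA₁0 hℓ₃ hΓlim
    have hκblim : Tendsto (fun s : ℝ => s * κb s) (nhdsWithin 0 (Set.Ioi 0)) (nhds 0) :=
      tendsto_mul_collar_rpow (by norm_num) hA₂0 hℓ₃ (tendsto_div_pow_atTop_of_le (by norm_num) hΓlim)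
    have hid : Tendsto (fun s : ℝ => s * T₀) (nhdsWithin 0 (Set.Ioi 0)) (nhds 0) := by
      have := (tendsto_id.mono_left nhdsWithin_le_nhds : Tendsto (fun s : ℝ => s) (nhdsWithin 0 (Set.Ioi 0))
        (nhds 0)).mul_const T₀
      simpa using this
    have hsum := (((hKlim.add hκalim).add hκblim).add hid).const_mul θ
    simp only [add_zero, mul_zero] at hsum
    refine hsum.congr' (Eventually.of_forall fun s => ?_)
    show θ * (s * K₃ s + s * κa s + s * κb s + s * T₀) = s * (θ * (K₃ s + κa s + κb s + T₀))
    ring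
  -- the main clause
  intro β hβ x R hb η n y z hnpos hn hy hz hKx hKy hKz
  have hβ₁ : β₁ ≤ β := le_trans (le_trans (le_max_left _ _) (le_max_left _ _)) hβ
  have hβU : βU ≤ β := le_trans (le_trans (le_max_right _ _) (le_max_left _ _)) hβ
  have hβ₃ : β₃ ≤ β := le_trans (le_max_right _ _) hβ
  have haβ := ha β
  set s : ℝ := (n : ℝ) * a β with hs
  have hs0 : 0 < s := hnpos
  have hnR0 : (0 : ℝ) ≤ n := Nat.cast_nonneg n
  have hnn₃ : n₃ ≤ n := le_trans (le_max_left _ _) hn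
  have hnD : D + 2 ≤ n := le_trans (le_trans (le_max_left _ _) (le_max_right _ _)) hn
  have hnδ : ⌈(n₀ : ℝ) / δ₀⌉₊ ≤ n := le_trans (le_trans (le_max_right _ _) (le_max_right _ _)) hn
  have hn2 : (2 : ℝ) ≤ n := by exact_mod_cast (le_trans (by omega : 2 ≤ D + 2) hnD)
  have hn0 : (0 : ℝ) < n := by linarith only [hn2]
  have hn₀δ : (n₀ : ℝ) ≤ δ₀ * n := by
    have h1 : (n₀ : ℝ) / δ₀ ≤ n := le_trans (Nat.le_ceil _) (by exact_mod_cast hnδ)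
    rwa [div_le_iff₀ hδ₀0, mul_comm] at h1
  -- norms of the three sides
  obtain ⟨hyl, hyu⟩ := norm_bounds_of_near hnR0 hy
  obtain ⟨hzl, hzu⟩ := norm_bounds_of_near hnR0 hz
  obtain ⟨hzyl, hzyu⟩ := norm_bounds_of_near hnR0 (norm_third_side_near hy hz)
  have hyx_le : ‖siteToE (y - x)‖ ≤ Λ * n := hyu.trans (mul_le_mul_of_nonneg_right hΛv hnR0)
  have hzx_le : ‖siteToE (z - x)‖ ≤ Λ * n := hzu.trans (mul_le_mul_of_nonneg_right hΛw hnR0)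
  have hwv : ‖w - v‖ ≤ ‖v‖ + ‖w‖ := by rw [norm_sub_rev]; exact norm_sub_le v w
  have hzy_le : ‖siteToE (z - y)‖ ≤ 2 * Λ * n := by
    refine hzyu.trans ?_
    have : ‖w - v‖ + 2 * δ ≤ 2 * Λ := by linarith only [hwv, hΛv, hΛw]
    exact mul_le_mul_of_nonneg_right this hnR0
  have hyx_ge : δ₀ * n ≤ ‖siteToE (y - x)‖ := (mul_le_mul_of_nonneg_right hδ₀v hnR0).trans hyl
  have hzx_ge : δ₀ * n ≤ ‖siteToE (z - x)‖ := (mul_le_mul_of_nonneg_right hδ₀w hnR0).trans hzl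
  have hzy_ge : δ₀ * n ≤ ‖siteToE (z - y)‖ := (mul_le_mul_of_nonneg_right hδ₀vw hnR0).trans hzyl
  have hδ₀n : 0 < δ₀ * n := mul_pos hδ₀0 hn0
  -- depth bookkeeping in the radius-`R` cube
  have hdR : (depth (fun j => x j - R) (2 * R + 1) y : ℝ) ≤ (R : ℝ) + 1 := by
    have h : depth (fun j => x j - R) (2 * R + 1) y ≤ R + 1 := by
      have h' : depth (fun j => x j - R) (2 * R + 1) y ≤
          min (y 0 - (x 0 - R) + 1).toNat ((x 0 - R) + (2 * R + 1 : ℕ) - y 0).toNat := by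
        unfold depth
        exact Finset.inf'_le _ (Finset.mem_univ (0 : Fin 4))
      omega
    exact_mod_cast h
  set T : ℝ := K₃ s + κa s + κb s + T₀ with hTdef
  have hT1 : 1 ≤ T := by rw [hTdef]; linarith only [hK1 s, hκa0 s, hκb0 s, hT₀1]
  have hK'n : K' s * n ≤ (R : ℝ) + 1 := hKy.trans hdR
  have hTn_le : T * n ≤ K' s * n := mul_le_mul_of_nonneg_right (hK'ge s) hnR0
  have hn_le : (n : ℝ) ≤ T * n := by
    calc (n : ℝ) = 1 * (n : ℝ) := (one_mul _).symm
      _ ≤ T * n := mul_le_mul_of_nonneg_right hT1 hnR0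
  have hRD : D ≤ R := by
    have h1 : ((D + 2 : ℕ) : ℝ) ≤ n := by exact_mod_cast hnD
    push_cast at h1
    have : (D : ℝ) ≤ R := by linarith only [h1, hn_le, hTn_le, hK'n]
    exact_mod_cast this
  -- the covering radius `R₀`
  obtain ⟨R₀, hR₀S, hR₀R, hθR⟩ := hcover R hRD
  have hsub : cubeEdges (fun j => x j - R₀) (2 * R₀ + 1) ⊆ cubeEdges (fun j => x j - R) (2 * R + 1) :=
    cubeEdges_xcentred_subset x hR₀R
  have h2R : ((2 * R₀ + 1 : ℕ) : ℝ) ≤ ((2 * R + 1 : ℕ) : ℝ) := by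
    exact_mod_cast (by omega : 2 * R₀ + 1 ≤ 2 * R + 1)
  have hbR₀ : ((2 * R₀ + 1 : ℕ) : ℝ) * a β ≤ min (min ℓ₁ ℓU) ℓ₃ := (mul_le_mul_of_nonneg_right h2R haβ.le).trans hb
  have hb₁ : ((2 * R₀ + 1 : ℕ) : ℝ) * a β ≤ ℓ₁ := hbR₀.trans ((min_le_left _ _).trans (min_le_left _ _))
  have hbU : ((2 * R₀ + 1 : ℕ) : ℝ) * a β ≤ ℓU := hbR₀.trans ((min_le_left _ _).trans (min_le_right _ _))
  have hb₃ : ((2 * R₀ + 1 : ℕ) : ℝ) * a β ≤ ℓ₃ := hbR₀.trans (min_le_right _ _)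
  -- `R₀ + 1 ≥ T n`
  have hR₀ge : T * n ≤ (R₀ : ℝ) + 1 := by
    have h1 : θ * (T * n) ≤ θ * ((R₀ : ℝ) + 1) := by
      calc θ * (T * n) = K' s * n := by show θ * (T * n) = θ * (K₃ s + κa s + κb s + T₀) * n; rw [hTdef]; ring
        _ ≤ (R : ℝ) + 1 := hK'n
        _ ≤ θ * ((R₀ : ℝ) + 1) := hθR
    exact le_of_mul_le_mul_left h1 hθ0
  -- depths in the radius-`R₀` cube: all three are at least `T' n`, `T' = K₃ + κa + κb + 2 κ₂ Λ + 1`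
  set T' : ℝ := K₃ s + κa s + κb s + 2 * (κ₂ : ℝ) * Λ + 1 with hT'def
  have hTT' : T' * n + Λ * n = T * n := by rw [hTdef, hT'def, hT₀def]; ring
  have hdx : T' * n ≤ (depth (fun j => x j - R₀) (2 * R₀ + 1) x : ℝ) := by
    have h1 := le_depth_cube x x R₀ (t := 0) (fun j => by simp)
    have h2 : 0 ≤ Λ * n := by positivity
    linarith only [h1, h2, hTT', hR₀ge]
  have hdy : T' * n ≤ (depth (fun j => x j - R₀) (2 * R₀ + 1) y : ℝ) := by
    have h1 := depth_xcentred_ge x y R₀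
    linarith only [h1, hyx_le, hTT', hR₀ge]
  have hdz : T' * n ≤ (depth (fun j => x j - R₀) (2 * R₀ + 1) z : ℝ) := by
    have h1 := depth_xcentred_ge x z R₀
    linarith only [h1, hzx_le, hTT', hR₀ge]
  -- consequences of `depth ≥ T' n`
  have hκs0 : 0 ≤ κa s + κb s := by linarith only [hκa0 s, hκb0 s]
  have hT'K' : K₃ s ≤ T' := by rw [hT'def]; linarith only [hκa0 s, hκb0 s, hκ₂Λ]
  have hT'K : K₃ s * n ≤ T' * n := mul_le_mul_of_nonneg_right hT'K' hnR0
  have h1κn : 0 < (1 + (κa s + κb s)) * n := mul_pos (by linarith only [hκs0]) hn0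
  have hT'κ' : 1 + (κa s + κb s) ≤ T' := by rw [hT'def]; linarith only [hK1 s, hκ₂Λ]
  have hT'κ : (1 + (κa s + κb s)) * n ≤ T' * n := mul_le_mul_of_nonneg_right hT'κ' hnR0
  have hT'pair : (κ₂ : ℝ) * (2 * Λ * n) ≤ T' * n := by
    have h1 : (κ₂ : ℝ) * (2 * Λ) = 2 * (κ₂ : ℝ) * Λ := by ring
    have h2 : (κ₂ : ℝ) * (2 * Λ) ≤ T' := by rw [h1, hT'def]; linarith only [hK1 s, hκa0 s, hκb0 s]
    calc (κ₂ : ℝ) * (2 * Λ * n) = (κ₂ : ℝ) * (2 * Λ) * n := by ring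
      _ ≤ T' * n := mul_le_mul_of_nonneg_right h2 hnR0
  have hT'2 : (2 : ℝ) ≤ T' * n := by
    have h1 : (2 : ℝ) ≤ T' := by rw [hT'def]; linarith only [hK1 s, hκa0 s, hκb0 s, hκ₂Λ]
    calc (2 : ℝ) ≤ 2 * 1 := by norm_num
      _ ≤ T' * n := mul_le_mul h1 (by linarith only [hn2]) zero_le_one (by linarith only [h1])
  have h2of : ∀ u : Fin 4 → ℤ, T' * n ≤ (depth (fun j => x j - R₀) (2 * R₀ + 1) u : ℝ) →
      2 ≤ depth (fun j => x j - R₀) (2 * R₀ + 1) u := fun u hu => by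
    have : ((2 : ℕ) : ℝ) ≤ depth (fun j => x j - R₀) (2 * R₀ + 1) u := by push_cast; exact hT'2.trans hu
    exact_mod_cast this
  -- the boundary law for the three `R₀`-kernel means
  set h₀ : ℝ := C₁ / ((1 + (κa s + κb s)) * n) ^ 4 with hh₀
  have hbl : ∀ u : Fin 4 → ℤ, T' * n ≤ (depth (fun j => x j - R₀) (2 * R₀ + 1) u : ℝ) →
      ∀ ζ : LGConfig 4 G, |kerE G r β (fun j => x j - R₀) (2 * R₀ + 1) ζ (dens G r u) - p β| ≤ h₀ :=
    fun u hu ζ => (HB β hβ₁ _ _ hb₁ ζ u (h2of u hu)).trans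
      (div_le_div_of_nonneg_left hC₁ (by positivity) (pow_le_pow_left₀ h1κn.le (hT'κ.trans hu) 4))
  -- the sign-free conditional clustering of the three pairs inside the `R₀`-cube
  set cc : ℝ := C₂' / (δ₀ * n) ^ 8 with hcc
  have hclu : ∀ u u' : Fin 4 → ℤ, δ₀ * n ≤ ‖siteToE (u' - u)‖ → ‖siteToE (u' - u)‖ ≤ 2 * Λ * n →
      T' * n ≤ (depth (fun j => x j - R₀) (2 * R₀ + 1) u : ℝ) →
      T' * n ≤ (depth (fun j => x j - R₀) (2 * R₀ + 1) u' : ℝ) →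
      ∀ ζ : LGConfig 4 G, |kerCov G r β (fun j => x j - R₀) (2 * R₀ + 1) ζ (dens G r u) (dens G r u')| ≤ cc := by
    intro u u' hlo hhi hu hu' ζ
    have hν0 : 0 < ‖siteToE (u' - u)‖ := lt_of_lt_of_le hδ₀n hlo
    have hκν : (κ₂ : ℝ) * ‖siteToE (u' - u)‖ ≤ T' * n :=
      (mul_le_mul_of_nonneg_left hhi hκ₂0).trans hT'pair
    have hU := HU β hβU _ _ hbU ζ u u' (hn₀δ.trans hlo) (hκν.trans hu) (hκν.trans hu')
    rw [abs_mul, abs_of_nonneg (by positivity : (0 : ℝ) ≤ ‖siteToE (u' - u)‖ ^ 8)] at hU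
    have hν8 : 0 < ‖siteToE (u' - u)‖ ^ 8 := by positivity
    have h1 : |kerCov G r β (fun j => x j - R₀) (2 * R₀ + 1) ζ (dens G r u) (dens G r u')| ≤
        C₂' / ‖siteToE (u' - u)‖ ^ 8 := by
      rw [le_div_iff₀ hν8, mul_comm]
      exact hU.trans (le_max_left _ _)
    refine h1.trans ?_
    rw [hcc]
    exact div_le_div_of_nonneg_left hC₂'0 (by positivity) (pow_le_pow_left₀ hδ₀n.le hlo 8)
  have hcyz := hclu y z hzy_ge hzy_le hdy hdz
  have hΛn : Λ * n ≤ 2 * Λ * n := by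
    have : 0 ≤ Λ * n := by positivity
    linarith only [this]
  have hcxz := hclu x z hzx_ge (hzx_le.trans hΛn) hdx hdz
  have hcxy := hclu x y hyx_ge (hyx_le.trans hΛn) hdx hdy
  -- the signed floor in the `R₀`-cube, for every exterior
  have hn12 : 0 < (n : ℝ) ^ 12 := by positivity
  have hfl : ∀ ζ : LGConfig 4 G, c₃ * Γ₃ s / (n : ℝ) ^ 12 ≤
      σ * kerK3 G r β (fun j => x j - R₀) (2 * R₀ + 1) ζ x y z := by
    intro ζ
    have := H β hβ₃ x R₀ hR₀S hb₃ ζ n y z hnpos hnn₃ hy hz (hT'K.trans hdx) (hT'K.trans hdy) (hT'K.trans hdz)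
    rw [div_le_iff₀ hn12]
    linarith only [this]
  -- law of total cumulance through the `R₀`-cube
  have htot := kerK3_lower_of_nested G r β hsub η x y z hσ (hbl x hdx) (hbl y hdy) (hbl z hdz) hcyz hcxz hcxy hfl
  -- absorption of the two error terms
  have hsℓ₃ : s ≤ ℓ₃ := by
    have h1 : (n : ℝ) ≤ (R : ℝ) + 1 := (hn_le.trans hTn_le).trans hK'n
    have h2 : (R : ℝ) + 1 ≤ ((2 * R + 1 : ℕ) : ℝ) := by push_cast; linarith only [(Nat.cast_nonneg R : (0 : ℝ) ≤ R)]
    calc s = (n : ℝ) * a β := rfl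
      _ ≤ ((2 * R + 1 : ℕ) : ℝ) * a β := mul_le_mul_of_nonneg_right (h1.trans h2) haβ.le
      _ ≤ ℓ₃ := hb.trans (min_le_right _ _)
  have hΓs : 0 < Γ₃ s := hΓpos s hs0 hsℓ₃
  have hmins : min s ℓ₃ = s := min_eq_left hsℓ₃
  have hκa_le : (max 0 (B₁ / (c₃ * Γ₃ s))) ^ ((4 : ℕ) : ℝ)⁻¹ ≤ κa s + κb s := by
    have he : κa s = (max 0 (B₁ / (c₃ * Γ₃ s))) ^ ((4 : ℕ) : ℝ)⁻¹ := by
      show (max 0 (B₁ / c₃ / Γ₃ (min s ℓ₃))) ^ ((4 : ℕ) : ℝ)⁻¹ = _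
      rw [hmins, div_div]
    linarith only [he.le, he.ge, hκb0 s]
  have hκb_le : (max 0 (B₂ / (c₃ * Γ₃ s))) ^ ((12 : ℕ) : ℝ)⁻¹ ≤ κa s + κb s := by
    have he : κb s = (max 0 (B₂ / (c₃ * Γ₃ s))) ^ ((12 : ℕ) : ℝ)⁻¹ := by
      show (max 0 (B₂ / c₃ / Γ₃ (min s ℓ₃))) ^ ((12 : ℕ) : ℝ)⁻¹ = _
      rw [hmins, div_div]
    linarith only [he.le, he.ge, hκa0 s]
  have hB₁le : B₁ ≤ c₃ * Γ₃ s * (1 + (κa s + κb s)) ^ 4 :=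
    le_mul_one_add_collar_pow (by norm_num) hc₃ hΓs hκa_le
  have hB₂le : B₂ ≤ c₃ * Γ₃ s * (1 + (κa s + κb s)) ^ 12 :=
    le_mul_one_add_collar_pow (by norm_num) hc₃ hΓs hκb_le
  have h1κ : 0 < 1 + (κa s + κb s) := by linarith only [hκs0]
  have hA1 : (n : ℝ) ^ 12 * (6 * h₀ * cc) ≤ c₃ * Γ₃ s / 4 := by
    have heq : (n : ℝ) ^ 12 * (6 * h₀ * cc) = B₁ / 4 / (1 + (κa s + κb s)) ^ 4 := by
      rw [hh₀, hcc, hB₁def]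
      field_simp
      ring
    rw [heq, div_le_iff₀ (by positivity)]
    calc B₁ / 4 ≤ c₃ * Γ₃ s * (1 + (κa s + κb s)) ^ 4 / 4 := by linarith only [hB₁le]
      _ = c₃ * Γ₃ s / 4 * (1 + (κa s + κb s)) ^ 4 := by ring
  have hA2 : (n : ℝ) ^ 12 * (8 * h₀ ^ 3) ≤ c₃ * Γ₃ s / 4 := by
    have heq : (n : ℝ) ^ 12 * (8 * h₀ ^ 3) = B₂ / 4 / (1 + (κa s + κb s)) ^ 12 := by
      rw [hh₀, hB₂def]
      field_simp
      ring
    rw [heq, div_le_iff₀ (by positivity)]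
    calc B₂ / 4 ≤ c₃ * Γ₃ s * (1 + (κa s + κb s)) ^ 12 / 4 := by linarith only [hB₂le]
      _ = c₃ * Γ₃ s / 4 * (1 + (κa s + κb s)) ^ 12 := by ring
  -- conclusion
  have hmul := mul_le_mul_of_nonneg_right htot hn12.le
  have hfleq : c₃ * Γ₃ s / (n : ℝ) ^ 12 * (n : ℝ) ^ 12 = c₃ * Γ₃ s := div_mul_cancel₀ _ hn12.ne'
  have hexp : (c₃ * Γ₃ s / (n : ℝ) ^ 12 - 6 * h₀ * cc - 8 * h₀ ^ 3) * (n : ℝ) ^ 12 =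
      c₃ * Γ₃ s - (n : ℝ) ^ 12 * (6 * h₀ * cc) - (n : ℝ) ^ 12 * (8 * h₀ ^ 3) := by
    rw [sub_mul, sub_mul, hfleq]; ring
  rw [hexp] at hmul
  show c₃ / 2 * Γ₃ s ≤ σ * (n : ℝ) ^ 12 * kerK3 G r β (fun j => x j - R) (2 * R + 1) η x y z
  have hcomm : σ * kerK3 G r β (fun j => x j - R) (2 * R + 1) η x y z * (n : ℝ) ^ 12 =
      σ * (n : ℝ) ^ 12 * kerK3 G r β (fun j => x j - R) (2 * R + 1) η x y z := by ring
  linarith only [hmul, hA1, hA2, hcomm]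

end Lattice

end Summit.QuantumFields.YangMills.Cruxes.NT.WeakPackage

end
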